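import Summits.QuantumFields.YangMills.Theorems.PoincareLipschitzWeakChainRuleShear
import Literature.Analysis.FunctionSpaces.MeyersSerrinProofs
import Literature.Analysis.FunctionSpaces.SobolevDomainNormProofs
import Mathlib.MeasureTheory.Function.ConvergenceInMeasure
import Mathlib.MeasureTheory.Integral.DominatedConvergence
import HarnessLib

/-!
# Crux `BlockLipschitzL` (stmt-QuantumFields-23533) ∕ `HistoryTailL` (stmt-QuantumFields-19936), LINE 25 «CompactnessTransfer» —
# FILE (CR) «THE NONLINEAR CHAIN RULE FOR SOBOLEV MAPS»

Cell `ym3-torus` (YM ladder rung R3 = continuum SU(2) Yang–Mills on T³ — a RUNG, NOT the Clay problem: not d = 4, not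
infinite volume, not a mass gap); WIDTH helper seat `ym-ust-19936-w2` g13.  Helper `--supports stmt-QuantumFields-19936`;
THEOREMS ONLY (0 `def`, 0 `sorry`, default heartbeats); imports: lit ✓`MeyersSerrinProofs` (Meyers–Serrin `H = W` on
arbitrary open sets, the Sobolev norm `eSobolevDomainNorm`, `hasWeakFDerivOn_of_contDiffOn`), lit ✓`SobolevDomainNormProofs`,
FILE β ✓`PoincareLipschitzWeakChainRuleShear` (only for the letter `integrableOn_smul_of_locallyIntegrableOn`), Mathlib
(convergence in measure, dominated convergence).

WHAT THIS FILE DOES.  ★★★ `hasWeakFDerivOn_comp_of_fderiv_bounded`: if `w : E → F` has the weak gradient `Gw` on the open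
set `Ω` (lit `HasWeakFDerivOn Ω μ w Gw`, `E` a finite-dimensional real inner-product space with an additive Haar measure
`μ`, `F` complete) and `N : F → F′` is smooth with GLOBALLY BOUNDED derivative `‖DN‖ ≤ C`, then `N ∘ w` has the weak
gradient `x ↦ DN(w x) ∘ Gw x` on `Ω` [Ziemer1989, Thm 2.1.11] [EvansGariepy1992, §4.2.2 Thm 4 (ii)].  Proof as printed:
on a compactly contained neighbourhood `Ω′` of the support of the test function, `w ∈ W^{1,1}(Ω′)`; Meyers–Serrin gives
`u_n ∈ C^∞(Ω′)` with `‖u_n − w‖_{W^{1,1}(Ω′)} → 0`; the classical identity for `N ∘ u_n` passes to the limit — the left side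
because `N` is `C`-Lipschitz, the right side by `‖DN‖ ≤ C` for `DN(u_n)(∇u_n − Gw)` and dominated convergence along an
a.e.-convergent subsequence for `(DN(u_n) − DN(w))·Gw`.  This is the continuum-side prerequisite for composing
`W^{1,2}` sphere maps with normalisations ∕ the Hardt–Kinderlehrer–Lin ray projection (stability inequality, compactness of
minimisers into `S³`).

HONEST SCOPE.  Sobolev calculus; nothing of (M), (C), (R), S1″, S2♭″, `hHalvingBand`, K1, `MeanDeviationL`, `BlockLipschitzL`,
`HistoryTailL` is proved here.  YM₃ on T³ is rung R3, not Clay; YM gap NOT proved; no summit statement is proved here.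

References: W. P. Ziemer, Weakly Differentiable Functions (1989) [Ziemer1989] (Thm 2.1.11); L. C. Evans, R. F. Gariepy,
Measure Theory and Fine Properties of Functions (1992) [EvansGariepy1992] (§4.2.2 Thm 4); N. Meyers, J. Serrin, PNAS 51
(1964) [MeyersSerrin1964].
-/

set_option autoImplicit false

noncomputable section

open MeasureTheory Set Function Filter Topology Metric TopologicalSpace
open scoped ContDiff ENNReal

namespace Summit.QuantumFields.YangMills.Theorems.PoincareLipschitzSobolevChainRule

open Literature.Analysis.FunctionSpaces
open Summit.QuantumFields.YangMills.Theorems.PoincareLipschitzWeakChainRuleShear (integrableOn_smul_of_locallyIntegrableOn)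

variable {E : Type*} [NormedAddCommGroup E] [InnerProductSpace ℝ E] [FiniteDimensional ℝ E]
  [MeasurableSpace E] [BorelSpace E] {μ : Measure E} [μ.IsAddHaarMeasure]
variable {F : Type*} [NormedAddCommGroup F] [NormedSpace ℝ F] [CompleteSpace F]
variable {F' : Type*} [NormedAddCommGroup F'] [NormedSpace ℝ F']

/-! ## §1 Letters -/

omit [InnerProductSpace ℝ E] [FiniteDimensional ℝ E] [MeasurableSpace E] [BorelSpace E] [CompleteSpace F] in
/-- **A `C¹` map with `‖DN‖ ≤ C` is `C`-Lipschitz.** [folklore] -/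
theorem norm_sub_le_of_fderiv_bounded [NormedSpace ℝ E] {N : F → F'} (hN : Differentiable ℝ N) {C : ℝ}
    (hC : ∀ y, ‖fderiv ℝ N y‖ ≤ C) (a b : F) : ‖N a - N b‖ ≤ C * ‖a - b‖ :=
  Convex.norm_image_sub_le_of_norm_fderiv_le (fun y _ => hN y) (fun y _ => hC y) convex_univ (mem_univ b) (mem_univ a)

/-- **From `W^{1,1}` convergence to `L¹` convergence of the function and of each directional derivative.** [folklore] -/
theorem tendsto_eLpNorm_of_tendsto_eSobolevDomainNorm {Ω : Opens E} {w : E → F} {Gw : E → E →L[ℝ] F}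
    (hw : HasWeakFDerivOn Ω μ w Gw) {u : ℕ → E → F} (hu : ∀ n, ContDiffOn ℝ ∞ (u n) (Ω : Set E))
    (hlim : Tendsto (fun n => eSobolevDomainNorm 1 1 Ω μ (w - u n)) atTop (𝓝 0)) :
    Tendsto (fun n => eLpNorm (fun x => w x - u n x) 1 (μ.restrict (Ω : Set E))) atTop (𝓝 0) ∧
      ∀ v : E, Tendsto (fun n => eLpNorm (fun x => Gw x v - fderiv ℝ (u n) x v) 1 (μ.restrict (Ω : Set E)))
        atTop (𝓝 0) := by
  have hsub : ∀ n, HasWeakFDerivOn Ω μ (w - u n) (Gw - fderiv ℝ (u n)) :=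
    fun n => hw.sub (MeyersSerrin.hasWeakFDerivOn_of_contDiffOn (μ := μ) (hu n))
  have hle0 : ∀ n, eLpNorm (fun x => w x - u n x) 1 (μ.restrict (Ω : Set E)) ≤ eSobolevDomainNorm 1 1 Ω μ (w - u n) :=
    fun n => eLpNorm_le_eSobolevDomainNorm
  refine ⟨tendsto_of_tendsto_of_tendsto_of_le_of_le tendsto_const_nhds hlim (fun _ => bot_le) hle0, ?_⟩
  -- basis components
  set b := Module.finBasis ℝ E
  have hcomp : ∀ i, Tendsto (fun n => eLpNorm (fun x => (Gw x - fderiv ℝ (u n) x) (b i)) 1 (μ.restrict (Ω : Set E)))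
      atTop (𝓝 0) := by
    intro i
    refine tendsto_of_tendsto_of_tendsto_of_le_of_le tendsto_const_nhds hlim (fun _ => bot_le) fun n => ?_
    rw [MeyersSerrin.eSobolevDomainNorm_succ_eq (hsub n)]
    refine le_trans ?_ le_add_self
    have := Finset.single_le_sum (f := fun i => eSobolevDomainNorm 0 1 Ω μ (fun x => (Gw - fderiv ℝ (u n)) x (b i)))
      (fun _ _ => bot_le) (Finset.mem_univ i)
    simpa only [eSobolevDomainNorm_zero, Pi.sub_apply] using this
  intro v
  -- expand `v` in the basis
  have hv : ∀ (T : E →L[ℝ] F), T v = ∑ i, b.repr v i • T (b i) := fun T => by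
    conv_lhs => rw [← b.sum_repr v]
    rw [map_sum]
    exact Finset.sum_congr rfl fun i _ => by rw [map_smul]
  have hle : ∀ n, eLpNorm (fun x => Gw x v - fderiv ℝ (u n) x v) 1 (μ.restrict (Ω : Set E)) ≤
      ∑ i, ‖b.repr v i‖ₑ * eLpNorm (fun x => (Gw x - fderiv ℝ (u n) x) (b i)) 1 (μ.restrict (Ω : Set E)) := by
    intro n
    have heq : (fun x => Gw x v - fderiv ℝ (u n) x v) =
        ∑ i, (fun x => b.repr v i • (Gw x - fderiv ℝ (u n) x) (b i)) := by
      funext x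
      rw [Finset.sum_apply, ← sub_apply, hv]
    rw [heq]
    refine (eLpNorm_sum_le (fun i _ => ?_) le_rfl).trans (Finset.sum_le_sum fun i _ => ?_)
    · exact ((hsub n).aestronglyMeasurable_deriv_apply (b i)).const_smul _
    · have : (fun x => b.repr v i • (Gw x - fderiv ℝ (u n) x) (b i)) =
          b.repr v i • (fun x => (Gw x - fderiv ℝ (u n) x) (b i)) := rfl
      rw [this, eLpNorm_const_smul]
  have hlim' : Tendsto (fun n => ∑ i, ‖b.repr v i‖ₑ *
      eLpNorm (fun x => (Gw x - fderiv ℝ (u n) x) (b i)) 1 (μ.restrict (Ω : Set E))) atTop (𝓝 0) := by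
    have : (0 : ℝ≥0∞) = ∑ i : Fin (Module.finrank ℝ E), ‖b.repr v i‖ₑ * 0 := by simp
    rw [this]
    exact tendsto_finsetSum _ fun i _ => ENNReal.Tendsto.const_mul (hcomp i) (Or.inr enorm_ne_top)
  exact tendsto_of_tendsto_of_tendsto_of_le_of_le tendsto_const_nhds hlim' (fun _ => bot_le) hle

/-! ## §2 The chain rule -/

/-- ★★★ **THE NONLINEAR CHAIN RULE FOR SOBOLEV MAPS.**  `w` weakly differentiable on the open `Ω` with weak gradient `Gw`,
`N ∈ C^∞(F, F′)` with `‖DN‖ ≤ C` everywhere ⇒ `N ∘ w` is weakly differentiable on `Ω` with weak gradient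
`x ↦ DN(w x) ∘ Gw x`.  Proof: Meyers–Serrin on a compactly contained neighbourhood of the support of the test function,
classical identity for `N ∘ u_n`, limits by the Lipschitz bound and dominated convergence along an a.e.-convergent
subsequence. [cite: Ziemer1989, Thm 2.1.11; EvansGariepy1992, §4.2.2 Thm 4 (ii)] -/
theorem hasWeakFDerivOn_comp_of_fderiv_bounded {Ω : Opens E} {w : E → F} {Gw : E → E →L[ℝ] F}
    (hw : HasWeakFDerivOn Ω μ w Gw) {N : F → F'} (hN : ContDiff ℝ ∞ N) {C : ℝ} (hC : ∀ y, ‖fderiv ℝ N y‖ ≤ C) :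
    HasWeakFDerivOn Ω μ (fun x => N (w x)) (fun x => (fderiv ℝ N (w x)).comp (Gw x)) := by
  have hNd : Differentiable ℝ N := hN.differentiable (by simp)
  have hNc : Continuous N := hN.continuous
  have hN'c : Continuous (fderiv ℝ N) := hN.continuous_fderiv (by simp)
  have hC0 : 0 ≤ C := (norm_nonneg _).trans (hC 0)
  have hΩlc : IsLocallyClosed (Ω : Set E) := Ω.isOpen.isLocallyClosed
  refine ⟨?_, ?_, fun φ v hφ => ?_⟩
  · -- local integrability of `N ∘ w`
    rw [locallyIntegrableOn_iff hΩlc]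
    intro K hK hKc
    have hwK : IntegrableOn w K μ := hw.locallyIntegrableOn.integrableOn_compact_subset hK hKc
    have hm : AEStronglyMeasurable (fun x => N (w x)) (μ.restrict K) :=
      hNc.comp_aestronglyMeasurable hwK.aestronglyMeasurable
    have hbound : IntegrableOn (fun x => ‖N 0‖ + C * ‖w x‖) K μ :=
      (integrableOn_const (hKc.measure_lt_top (μ := μ)).ne).add (hwK.norm.const_mul C)
    refine Integrable.mono' hbound hm (Filter.Eventually.of_forall fun x => ?_)
    have h1 := norm_sub_le_of_fderiv_bounded (E := E) hNd hC (w x) 0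
    rw [sub_zero] at h1
    calc ‖N (w x)‖ = ‖(N (w x) - N 0) + N 0‖ := by rw [sub_add_cancel]
      _ ≤ ‖N (w x) - N 0‖ + ‖N 0‖ := norm_add_le _ _
      _ ≤ ‖N 0‖ + C * ‖w x‖ := by linarith
  · -- local integrability of `DN(w) ∘ Gw`
    rw [locallyIntegrableOn_iff hΩlc]
    intro K hK hKc
    have hGK : IntegrableOn Gw K μ := hw.locallyIntegrableOn_deriv.integrableOn_compact_subset hK hKc
    have hwK : IntegrableOn w K μ := hw.locallyIntegrableOn.integrableOn_compact_subset hK hKc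
    have hm : AEStronglyMeasurable (fun x => (fderiv ℝ N (w x)).comp (Gw x)) (μ.restrict K) := by
      have := (ContinuousLinearMap.compL ℝ E F F').aestronglyMeasurable_comp₂
        (hN'c.comp_aestronglyMeasurable hwK.aestronglyMeasurable) hGK.aestronglyMeasurable
      simpa only [ContinuousLinearMap.compL_apply] using this
    refine Integrable.mono' (hGK.norm.const_mul C) hm (Filter.Eventually.of_forall fun x => ?_)
    exact (ContinuousLinearMap.opNorm_comp_le _ _).trans (mul_le_mul_of_nonneg_right (hC _) (norm_nonneg _))
  · -- the integration-by-parts identity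
    -- (1) a compactly contained open neighbourhood `Ω'` of `tsupport φ`
    obtain ⟨δ, hδ, hδΩ⟩ := hφ.hasCompactSupport.exists_cthickening_subset_open Ω.isOpen hφ.tsupport_subset
    set Ω' : Opens E := ⟨thickening δ (tsupport φ), isOpen_thickening⟩ with hΩ'def
    have hΩ'K : tsupport φ ⊆ (Ω' : Set E) := self_subset_thickening hδ _
    have hΩ'c : (Ω' : Set E) ⊆ cthickening δ (tsupport φ) := thickening_subset_cthickening δ _
    have hKc : IsCompact (cthickening δ (tsupport φ)) :=
      isCompact_of_isClosed_isBounded isClosed_cthickening hφ.hasCompactSupport.isBounded.cthickening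
    have hΩ'Ω : (Ω' : Set E) ⊆ (Ω : Set E) := hΩ'c.trans hδΩ
    have hΩ'le : Ω' ≤ Ω := hΩ'Ω
    have hΩ'm : MeasurableSet (Ω' : Set E) := Ω'.isOpen.measurableSet
    -- (2) `w ∈ W^{1,1}(Ω')`
    have hw' : HasWeakFDerivOn Ω' μ w Gw := HasWeakFDerivOn.mono_set_holds hw hΩ'le
    have hwI : IntegrableOn w (Ω' : Set E) μ :=
      (hw.locallyIntegrableOn.integrableOn_compact_subset hδΩ hKc).mono_set hΩ'c
    have hGI : IntegrableOn Gw (Ω' : Set E) μ :=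
      (hw.locallyIntegrableOn_deriv.integrableOn_compact_subset hδΩ hKc).mono_set hΩ'c
    have hmem : MemSobolevDomain 1 1 Ω' μ w := by
      rw [memSobolevDomain_succ_iff]
      refine ⟨memLp_one_iff_integrable.mpr hwI, Gw, hw', fun v => ?_⟩
      rw [memSobolevDomain_zero_iff, memLp_one_iff_integrable]
      exact (ContinuousLinearMap.apply ℝ F v).integrable_comp hGI
    -- (3) Meyers–Serrin on `Ω'`
    obtain ⟨u, hu, hlim⟩ := MeyersSerrin.exists_contDiffOn_tendsto_eSobolevDomainNorm_sub (Ω := Ω') (μ := μ)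
      (p := 1) le_rfl ENNReal.one_ne_top hmem
    obtain ⟨hL1, hD1⟩ := tendsto_eLpNorm_of_tendsto_eSobolevDomainNorm hw' hu hlim
    -- (4) the classical identity for `N ∘ u n` on `Ω'`
    have hφ' : IsTestFunctionOn Ω' φ := ⟨hφ.contDiff, hφ.hasCompactSupport, hΩ'K⟩
    have hNu : ∀ n, ContDiffOn ℝ ∞ (fun x => N (u n x)) (Ω' : Set E) := fun n => hN.comp_contDiffOn (hu n)
    have hNu' : ∀ n x, x ∈ (Ω' : Set E) →
        fderiv ℝ (fun x => N (u n x)) x = (fderiv ℝ N (u n x)).comp (fderiv ℝ (u n) x) := by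
      intro n x hx
      have hux : DifferentiableAt ℝ (u n) x :=
        ((hu n).differentiableOn (by simp)).differentiableAt (Ω'.isOpen.mem_nhds hx)
      exact fderiv_comp x (hNd _) hux
    have idn : ∀ n, ∫ x in (Ω' : Set E), (fderiv ℝ φ x v) • N (u n x) ∂μ =
        -∫ x in (Ω' : Set E), φ x • (fderiv ℝ N (u n x)) (fderiv ℝ (u n) x v) ∂μ := by
      intro n
      have h := (MeyersSerrin.hasWeakFDerivOn_of_contDiffOn (μ := μ) (hNu n)).integral_fderiv_smul_eq φ v hφ'
      rw [h]
      congr 1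
      refine setIntegral_congr_fun hΩ'm fun x hx => ?_
      rw [hNu' n x hx, ContinuousLinearMap.comp_apply]
    -- (5) measurability letters on `Ω'`
    have hum : ∀ n, AEStronglyMeasurable (u n) (μ.restrict (Ω' : Set E)) :=
      fun n => ((hu n).continuousOn).aestronglyMeasurable hΩ'm
    have hu'm : ∀ n, AEStronglyMeasurable (fun x => fderiv ℝ (u n) x v) (μ.restrict (Ω' : Set E)) :=
      fun n => (((hu n).continuousOn_fderiv_of_isOpen Ω'.isOpen (by simp)).clm_apply continuousOn_const)
        |>.aestronglyMeasurable hΩ'm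
    have hwm' : AEStronglyMeasurable w (μ.restrict (Ω' : Set E)) := hwI.aestronglyMeasurable
    have hGvI : Integrable (fun x => Gw x v) (μ.restrict (Ω' : Set E)) :=
      (ContinuousLinearMap.apply ℝ F v).integrable_comp hGI
    have hGvm : AEStronglyMeasurable (fun x => Gw x v) (μ.restrict (Ω' : Set E)) := hGvI.aestronglyMeasurable
    have hφc : Continuous φ := hφ.contDiff.continuous
    have hφ'c : Continuous fun x => fderiv ℝ φ x v :=
      (hφ.contDiff.continuous_fderiv (by simp)).clm_apply continuous_const
    -- applying a measurable operator field to a measurable vector field is measurable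
    have happly : ∀ {T : E → F →L[ℝ] F'} {y : E → F},
        AEStronglyMeasurable T (μ.restrict (Ω' : Set E)) → AEStronglyMeasurable y (μ.restrict (Ω' : Set E)) →
        AEStronglyMeasurable (fun x => T x (y x)) (μ.restrict (Ω' : Set E)) := by
      intro T y hT hy
      have := (ContinuousLinearMap.apply ℝ F').aestronglyMeasurable_comp₂ hy hT
      simpa only [ContinuousLinearMap.apply_apply] using this
    have hDNum : ∀ n, AEStronglyMeasurable (fun x => fderiv ℝ N (u n x)) (μ.restrict (Ω' : Set E)) :=
      fun n => hN'c.comp_aestronglyMeasurable (hum n)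
    have hDNwm : AEStronglyMeasurable (fun x => fderiv ℝ N (w x)) (μ.restrict (Ω' : Set E)) :=
      hN'c.comp_aestronglyMeasurable hwm'
    -- (6) an a.e.-convergent subsequence
    have hmeas : TendstoInMeasure (μ.restrict (Ω' : Set E)) u atTop w := by
      refine tendstoInMeasure_of_tendsto_eLpNorm one_ne_zero hum hwm' ?_
      refine (tendsto_congr fun n => ?_).mp hL1
      rw [← eLpNorm_neg]
      congr 1
      funext x
      simp
    obtain ⟨ns, hns, hae⟩ := hmeas.exists_seq_tendsto_ae
    -- (7) bounds for the test function
    obtain ⟨Mφ, hMφ⟩ := hφ.hasCompactSupport.exists_bound_of_continuous hφc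
    obtain ⟨Mφ', hMφ'⟩ := (hφ.hasCompactSupport.fderiv_apply (𝕜 := ℝ) v).exists_bound_of_continuous hφ'c
    have hMφ0 : 0 ≤ Mφ := (norm_nonneg _).trans (hMφ 0)
    have hMφ'0 : 0 ≤ Mφ' := (norm_nonneg _).trans (hMφ' 0)
    -- (8) LHS limit (full sequence): Lipschitz bound
    have lhs_int : ∀ n, Integrable (fun x => (fderiv ℝ φ x v) • N (u n x)) (μ.restrict (Ω' : Set E)) :=
      fun n => integrableOn_smul_of_locallyIntegrableOn
        (MeyersSerrin.hasWeakFDerivOn_of_contDiffOn (μ := μ) (hNu n)).locallyIntegrableOn hφ'c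
        (hφ.hasCompactSupport.fderiv_apply (𝕜 := ℝ) v) ((tsupport_fderiv_apply_subset ℝ v).trans hΩ'K)
    have lhs_lim : Tendsto (fun n => ∫ x in (Ω' : Set E), (fderiv ℝ φ x v) • N (u n x) ∂μ) atTop
        (𝓝 (∫ x in (Ω' : Set E), (fderiv ℝ φ x v) • N (w x) ∂μ)) := by
      refine tendsto_integral_of_L1 _ (hφ'c.aestronglyMeasurable.smul (hNc.comp_aestronglyMeasurable hwm'))
        (Filter.Eventually.of_forall lhs_int) ?_
      have hb : ∀ n, ∫⁻ x in (Ω' : Set E), ‖(fderiv ℝ φ x v) • N (u n x) - (fderiv ℝ φ x v) • N (w x)‖ₑ ∂μ ≤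
          ENNReal.ofReal (Mφ' * C) * eLpNorm (fun x => w x - u n x) 1 (μ.restrict (Ω' : Set E)) := by
        intro n
        rw [eLpNorm_one_eq_lintegral_enorm, ← lintegral_const_mul' _ _ ENNReal.ofReal_ne_top]
        refine lintegral_mono fun x => ?_
        rw [← ofReal_norm, ← ofReal_norm, ← ENNReal.ofReal_mul (by positivity)]
        refine ENNReal.ofReal_le_ofReal ?_
        have h1 := norm_sub_le_of_fderiv_bounded (E := E) hNd hC (u n x) (w x)
        rw [← smul_sub, norm_smul, norm_sub_rev (w x)]
        calc ‖fderiv ℝ φ x v‖ * ‖N (u n x) - N (w x)‖ ≤ Mφ' * (C * ‖u n x - w x‖) :=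
              mul_le_mul (hMφ' x) h1 (norm_nonneg _) hMφ'0
          _ = Mφ' * C * ‖u n x - w x‖ := by ring
      have h0 : Tendsto (fun n => ENNReal.ofReal (Mφ' * C) * eLpNorm (fun x => w x - u n x) 1
          (μ.restrict (Ω' : Set E))) atTop (𝓝 0) := by
        have := ENNReal.Tendsto.const_mul (a := ENNReal.ofReal (Mφ' * C)) hL1 (Or.inr ENNReal.ofReal_ne_top)
        simpa only [mul_zero] using this
      exact tendsto_of_tendsto_of_tendsto_of_le_of_le tendsto_const_nhds h0 (fun _ => bot_le) hb
    -- (9) RHS limit along the subsequence, in `L¹`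
    -- (9a) the `A`-part: `φ • DN(u)(∇u v − Gw v)` is eventually integrable and → 0 in `L¹`
    have hDiffI : ∀ᶠ n in atTop, Integrable (fun x => Gw x v - fderiv ℝ (u n) x v) (μ.restrict (Ω' : Set E)) := by
      have hlt : ∀ᶠ n in atTop, eLpNorm (fun x => Gw x v - fderiv ℝ (u n) x v) 1 (μ.restrict (Ω' : Set E)) < 1 :=
        (hD1 v).eventually (gt_mem_nhds zero_lt_one)
      filter_upwards [hlt] with n hn
      exact memLp_one_iff_integrable.mp ⟨hGvm.sub (hu'm n), hn.trans ENNReal.one_lt_top⟩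
    have hRint : ∀ᶠ n in atTop,
        Integrable (fun x => φ x • (fderiv ℝ N (u n x)) (fderiv ℝ (u n) x v)) (μ.restrict (Ω' : Set E)) := by
      filter_upwards [hDiffI] with n hn
      have hder : Integrable (fun x => fderiv ℝ (u n) x v) (μ.restrict (Ω' : Set E)) := by
        have := hGvI.sub hn
        refine this.congr (Filter.Eventually.of_forall fun x => ?_)
        simp only [Pi.sub_apply, sub_sub_cancel]
      have hm : AEStronglyMeasurable (fun x => φ x • (fderiv ℝ N (u n x)) (fderiv ℝ (u n) x v))
          (μ.restrict (Ω' : Set E)) := hφc.aestronglyMeasurable.smul (happly (hDNum n) (hu'm n))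
      refine Integrable.mono' (hder.norm.const_mul (Mφ * C)) hm (Filter.Eventually.of_forall fun x => ?_)
      rw [norm_smul]
      calc ‖φ x‖ * ‖(fderiv ℝ N (u n x)) (fderiv ℝ (u n) x v)‖ ≤ Mφ * (C * ‖fderiv ℝ (u n) x v‖) :=
            mul_le_mul (hMφ x) ((ContinuousLinearMap.le_opNorm _ _).trans
              (mul_le_mul_of_nonneg_right (hC _) (norm_nonneg _))) (norm_nonneg _) hMφ0
        _ = Mφ * C * ‖fderiv ℝ (u n) x v‖ := by ring
    -- the `L¹` distance to the limit, bounded by the two parts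
    have hsplit : ∀ n x, ‖φ x • (fderiv ℝ N (u n x)) (fderiv ℝ (u n) x v) - φ x • (fderiv ℝ N (w x)) (Gw x v)‖ₑ ≤
        ENNReal.ofReal (Mφ * C) * ‖Gw x v - fderiv ℝ (u n) x v‖ₑ +
          ‖φ x • (fderiv ℝ N (u n x)) (Gw x v) - φ x • (fderiv ℝ N (w x)) (Gw x v)‖ₑ := by
      intro n x
      have heq : φ x • (fderiv ℝ N (u n x)) (fderiv ℝ (u n) x v) - φ x • (fderiv ℝ N (w x)) (Gw x v) =
          φ x • (fderiv ℝ N (u n x)) (fderiv ℝ (u n) x v - Gw x v) +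
            (φ x • (fderiv ℝ N (u n x)) (Gw x v) - φ x • (fderiv ℝ N (w x)) (Gw x v)) := by
        rw [map_sub, smul_sub]; abel
      rw [heq]
      refine (enorm_add_le _ _).trans (add_le_add ?_ le_rfl)
      rw [← ofReal_norm, ← ofReal_norm, ← ENNReal.ofReal_mul (by positivity)]
      refine ENNReal.ofReal_le_ofReal ?_
      rw [norm_smul, norm_sub_rev (Gw x v)]
      calc ‖φ x‖ * ‖(fderiv ℝ N (u n x)) (fderiv ℝ (u n) x v - Gw x v)‖
          ≤ Mφ * (C * ‖fderiv ℝ (u n) x v - Gw x v‖) :=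
            mul_le_mul (hMφ x) ((ContinuousLinearMap.le_opNorm _ _).trans
              (mul_le_mul_of_nonneg_right (hC _) (norm_nonneg _))) (norm_nonneg _) hMφ0
        _ = Mφ * C * ‖fderiv ℝ (u n) x v - Gw x v‖ := by ring
    -- (9b) the `A`-part tends to `0` in `L¹` (full sequence)
    have hA : Tendsto (fun n => ∫⁻ x in (Ω' : Set E), ENNReal.ofReal (Mφ * C) * ‖Gw x v - fderiv ℝ (u n) x v‖ₑ ∂μ)
        atTop (𝓝 0) := by
      have h1 : ∀ n, ∫⁻ x in (Ω' : Set E), ENNReal.ofReal (Mφ * C) * ‖Gw x v - fderiv ℝ (u n) x v‖ₑ ∂μ =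
          ENNReal.ofReal (Mφ * C) * eLpNorm (fun x => Gw x v - fderiv ℝ (u n) x v) 1 (μ.restrict (Ω' : Set E)) := by
        intro n
        rw [eLpNorm_one_eq_lintegral_enorm, lintegral_const_mul' _ _ ENNReal.ofReal_ne_top]
      simp_rw [h1]
      have := ENNReal.Tendsto.const_mul (a := ENNReal.ofReal (Mφ * C)) (hD1 v) (Or.inr ENNReal.ofReal_ne_top)
      simpa only [mul_zero] using this
    -- (9c) the `B`-part along the subsequence: dominated convergence
    have hB : Tendsto (fun k => ∫⁻ x in (Ω' : Set E),
        ENNReal.ofReal ‖φ x • (fderiv ℝ N (u (ns k) x)) (Gw x v) - φ x • (fderiv ℝ N (w x)) (Gw x v)‖ ∂μ)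
        atTop (𝓝 0) := by
      refine tendsto_lintegral_norm_of_dominated_convergence (bound := fun x => Mφ * C * ‖Gw x v‖)
        (fun k => hφc.aestronglyMeasurable.smul (happly (hDNum (ns k)) hGvm))
        ((hGvI.norm.const_mul (Mφ * C)).hasFiniteIntegral) (fun k => Filter.Eventually.of_forall fun x => ?_) ?_
      · rw [norm_smul]
        calc ‖φ x‖ * ‖(fderiv ℝ N (u (ns k) x)) (Gw x v)‖ ≤ Mφ * (C * ‖Gw x v‖) :=
              mul_le_mul (hMφ x) ((ContinuousLinearMap.le_opNorm _ _).trans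
                (mul_le_mul_of_nonneg_right (hC _) (norm_nonneg _))) (norm_nonneg _) hMφ0
          _ = Mφ * C * ‖Gw x v‖ := by ring
      · filter_upwards [hae] with x hx
        have h1 : Tendsto (fun k => fderiv ℝ N (u (ns k) x)) atTop (𝓝 (fderiv ℝ N (w x))) :=
          (hN'c.tendsto _).comp hx
        have h2 : Tendsto (fun k => (fderiv ℝ N (u (ns k) x)) (Gw x v)) atTop (𝓝 ((fderiv ℝ N (w x)) (Gw x v))) :=
          ((ContinuousLinearMap.apply ℝ F' (Gw x v)).continuous.tendsto _).comp h1
        exact h2.const_smul (φ x)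
    -- (9d) `R (ns k) → R` by `L¹` convergence
    have hR_lim : Tendsto (fun k => ∫ x in (Ω' : Set E), φ x • (fderiv ℝ N (u (ns k) x)) (fderiv ℝ (u (ns k)) x v) ∂μ)
        atTop (𝓝 (∫ x in (Ω' : Set E), φ x • (fderiv ℝ N (w x)) (Gw x v) ∂μ)) := by
      refine tendsto_integral_of_L1 _ (hφc.aestronglyMeasurable.smul (happly hDNwm hGvm))
        (hns.tendsto_atTop.eventually hRint) ?_
      have hA' : Tendsto (fun k => ∫⁻ x in (Ω' : Set E), ENNReal.ofReal (Mφ * C) *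
          ‖Gw x v - fderiv ℝ (u (ns k)) x v‖ₑ ∂μ) atTop (𝓝 0) := hA.comp hns.tendsto_atTop
      have hsum : Tendsto (fun k => (∫⁻ x in (Ω' : Set E), ENNReal.ofReal (Mφ * C) *
            ‖Gw x v - fderiv ℝ (u (ns k)) x v‖ₑ ∂μ) +
          ∫⁻ x in (Ω' : Set E), ENNReal.ofReal ‖φ x • (fderiv ℝ N (u (ns k) x)) (Gw x v) -
            φ x • (fderiv ℝ N (w x)) (Gw x v)‖ ∂μ) atTop (𝓝 0) := by
        have := hA'.add hB
        simpa only [add_zero] using this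
      refine tendsto_of_tendsto_of_tendsto_of_le_of_le tendsto_const_nhds hsum (fun _ => bot_le) fun k => ?_
      rw [← lintegral_add_left' ?_]
      · refine lintegral_mono fun x => ?_
        have := hsplit (ns k) x
        rwa [ofReal_norm]
      · exact ((hGvm.sub (hu'm (ns k))).enorm.const_mul _)
    -- (10) identity on `Ω'`
    have hΩ'id : ∫ x in (Ω' : Set E), (fderiv ℝ φ x v) • N (w x) ∂μ =
        -∫ x in (Ω' : Set E), φ x • (fderiv ℝ N (w x)) (Gw x v) ∂μ := by
      have h1 : Tendsto (fun k => ∫ x in (Ω' : Set E), (fderiv ℝ φ x v) • N (u (ns k) x) ∂μ) atTop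
          (𝓝 (∫ x in (Ω' : Set E), (fderiv ℝ φ x v) • N (w x) ∂μ)) := lhs_lim.comp hns.tendsto_atTop
      have h2 : Tendsto (fun k => ∫ x in (Ω' : Set E), (fderiv ℝ φ x v) • N (u (ns k) x) ∂μ) atTop
          (𝓝 (-∫ x in (Ω' : Set E), φ x • (fderiv ℝ N (w x)) (Gw x v) ∂μ)) := by
        have := hR_lim.neg
        refine this.congr fun k => ?_
        exact (idn (ns k)).symm
      exact tendsto_nhds_unique h1 h2
    -- (11) transfer from `Ω'` to `Ω`
    have hΩm : MeasurableSet (Ω : Set E) := Ω.isOpen.measurableSet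
    have hzero : ∀ x, x ∉ (Ω' : Set E) → φ x = 0 := fun x hx =>
      image_eq_zero_of_notMem_tsupport fun h => hx (hΩ'K h)
    have hzero' : ∀ x, x ∉ (Ω' : Set E) → fderiv ℝ φ x v = 0 := fun x hx =>
      image_eq_zero_of_notMem_tsupport (f := fun x => fderiv ℝ φ x v)
        fun h => hx (hΩ'K (tsupport_fderiv_apply_subset ℝ v h))
    rw [setIntegral_eq_of_subset_of_forall_sdiff_eq_zero hΩm hΩ'Ω fun x hx => by
        rw [hzero' x hx.2, zero_smul],
      setIntegral_eq_of_subset_of_forall_sdiff_eq_zero hΩm hΩ'Ω fun x hx => by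
        rw [hzero x hx.2, zero_smul]]
    exact hΩ'id

end Summit.QuantumFields.YangMills.Theorems.PoincareLipschitzSobolevChainRule

end
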